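import Summits.AtomisticToContinuum.Crystallization.Theses.ChessboardParticlePlanes
import Literature.MathematicalPhysics.StatisticalMechanics.PeriodicConfigurationSums
import Summits.AtomisticToContinuum.Crystallization.Theorems.ChessboardParticlePlanesLjPlaneChessboardRestack

/-!
# Crux `ChessboardParticlePlanes.LjPlaneChessboard` (stmt-AtomisticToContinuum-6709), line `Sketch`,
# stub `siteSum_layers_restackDn` — the site sum of the downward restack, plane by plane

Let `Q` be a periodic configuration of `ℝ³` with two `ℝ`-independent horizontal periods, let
`x ∈ Q.points` and let `t = τd (x 2) < x 2` be an occupied height; put `c = x 2 - t > 0` and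
`e = e₃`.  The downward restack of the two layers `{x₂ = t}` and `{x₂ = x 2}` is

  `R = {x' + 2ck • e : k ∈ ℤ, x' ∈ Q.points, x'₂ ∈ {t, x 2}}`.

CLAIM.  The Lennard-Jones site sum of `R` at `x` splits plane by plane,

  `∑'_{y ∈ R, y ≠ x} V(|x - y|) = ∑'_{y₂ = x 2, y ≠ x} V(|x - y|)`
    `+ ∑'_{k ≠ 0} ∑'_{y₂ = x 2} V(√(‖x - y‖² + (2|k|c)²))`
    `+ ∑'_{k ∈ ℤ} ∑'_{y₂ = t} V(√(‖x - y‖² - c² + (|2k+1|c)²))`,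

the two outer families being summable. [folklore]

PROOF.  `(x', k) ↦ x' + 2ck • e` is a bijection from `({x₂ = t} ∪ {x₂ = x 2}) × ℤ` onto `R`
(coordinate `2` of `x' + 2cke` is `x'₂ + 2ck` with `x'₂ ∈ {t, t + c}`, which pins down `k` by
parity and then `x'`), and `x` corresponds to `(x, 0)`.  Hence `R ∖ {x}` is parametrised by the
sum of `{y : y₂ = x 2, y ≠ x}` (`k = 0`), `{k ≠ 0} × {y₂ = x 2}` and `ℤ × {y₂ = t}`, where in
the last factor we use `(k, x') ↦ x' - 2ck • e` (the reflection `k ↦ -k` of `ℤ`) so as to land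
on the stated `|2k + 1|` form.  The site sum over `R ∖ {x}` is absolutely summable because `R`
is the point set of a periodic configuration (`stub_restack`,
`PeriodicConfiguration.summable_lennardJones_dist_three`), so it splits over the sum type and
the two products (`Summable.tsum_sum`, `Summable.tsum_prod`).  Pointwise,
`|x - (y + s e)|² = ‖x - y‖² - 2s(x₂ - y₂) + s²`; with `x₂ - y₂ = 0`, `s = 2ck` this is
`‖x - y‖² + (2|k|c)²`, and with `x₂ - y₂ = c`, `s = -2ck` it is `‖x - y‖² - c² + ((2k+1)c)²`.

No definition and no notation is introduced.
-/

noncomputable section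

namespace Summit.AtomisticToContinuum.Crystallization.Theorems.ChessboardParticlePlanesLjPlaneChessboard

open Literature.MathematicalPhysics.StatisticalMechanics

/-- Distance to a vertically shifted point: with `h = x₂ - y₂`,
`|x - (y + s e₃)| = √(‖x - y‖² - h² + (h - s)²)` (the horizontal part of `x - y` is unchanged,
the vertical offset becomes `h - s`). [folklore] -/
theorem restackDn_dist_shift (x y : EuclideanSpace ℝ (Fin 3)) (s : ℝ) :
    dist x (y + s • EuclideanSpace.single (2 : Fin 3) (1 : ℝ)) =
      Real.sqrt (‖x - y‖ ^ 2 - (x 2 - y 2) ^ 2 + ((x 2 - y 2) - s) ^ 2) := by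
  have h : dist x (y + s • EuclideanSpace.single (2 : Fin 3) (1 : ℝ)) ^ 2 =
      ‖x - y‖ ^ 2 - (x 2 - y 2) ^ 2 + ((x 2 - y 2) - s) ^ 2 := by
    rw [dist_eq_norm, ← sub_sub, norm_sub_sq_real, real_inner_smul_right,
      EuclideanSpace.inner_single_right, norm_smul, PiLp.norm_single]
    simp only [PiLp.sub_apply, conj_trivial, Real.norm_eq_abs, one_mul, mul_pow, sq_abs, norm_one]
    ring
  rw [← h, Real.sqrt_sq dist_nonneg]

/-- Uniqueness of the restack representation: if `y + 2ck e₃ = y' + 2ck' e₃` with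
`c = x₂ - t ≠ 0` and `y₂, y'₂ ∈ {t, x₂}`, then `k = k'` and `y = y'` (coordinate `2` gives
`2(k - k')c ∈ {0, ±c}`, and `2(k - k') ∈ {0, ±1}` forces `k = k'`). [folklore] -/
theorem restackDn_rep_unique {t x₂ : ℝ} (hc : x₂ - t ≠ 0) {y y' : EuclideanSpace ℝ (Fin 3)}
    {k k' : ℤ} (hy : y 2 = t ∨ y 2 = x₂) (hy' : y' 2 = t ∨ y' 2 = x₂)
    (h : y + ((2 * (x₂ - t)) * (k : ℝ)) • EuclideanSpace.single (2 : Fin 3) (1 : ℝ) =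
      y' + ((2 * (x₂ - t)) * (k' : ℝ)) • EuclideanSpace.single (2 : Fin 3) (1 : ℝ)) :
    k = k' ∧ y = y' := by
  suffices hk : k = k' by
    subst hk
    exact ⟨rfl, add_right_cancel h⟩
  have h2 : y 2 + 2 * (x₂ - t) * k = y' 2 + 2 * (x₂ - t) * k' := by
    have := congrArg (fun p : EuclideanSpace ℝ (Fin 3) => p 2) h
    simpa using this
  have key : (2 * ((k : ℝ) - k')) * (x₂ - t) = y' 2 - y 2 := by linear_combination h2
  obtain ⟨q, hq, hqk⟩ : ∃ q : ℤ, (q = 0 ∨ q = 1 ∨ q = -1) ∧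
      (2 * ((k : ℝ) - k')) * (x₂ - t) = (q : ℝ) * (x₂ - t) := by
    rcases hy with h1 | h1 <;> rcases hy' with h1' | h1'
    · exact ⟨0, Or.inl rfl, by rw [key, h1, h1']; push_cast; ring⟩
    · exact ⟨1, Or.inr (Or.inl rfl), by rw [key, h1, h1']; push_cast; ring⟩
    · exact ⟨-1, Or.inr (Or.inr rfl), by rw [key, h1, h1']; push_cast; ring⟩
    · exact ⟨0, Or.inl rfl, by rw [key, h1, h1']; push_cast; ring⟩
  have h3 : (2 * (k - k') : ℤ) = q := by
    have := mul_right_cancel₀ hc hqk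
    exact_mod_cast this
  omega

/-- **Parametrisation of the punctured restack.**  For `t < x 2` the set `R ∖ {x}`,
`R = {x' + 2(x 2 - t)k • e₃ : k ∈ ℤ, x' ∈ Q.points, x'₂ ∈ {t, x 2}}`, is in bijection with the
sum of `{y ∈ Q.points : y₂ = x 2, y ≠ x}` (`y ↦ y`), `{k ≠ 0} × {y ∈ Q.points : y₂ = x 2}`
(`(k, y) ↦ y + 2(x 2 - t)k • e₃`) and `ℤ × {y ∈ Q.points : y₂ = t}`
(`(k, y) ↦ y - 2(x 2 - t)k • e₃`). [folklore] -/
theorem restackDn_equiv (Q : PeriodicConfiguration 3) (x : EuclideanSpace ℝ (Fin 3)) {t : ℝ}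
    (ht : t < x 2) :
    ∃ E : ({y : EuclideanSpace ℝ (Fin 3) // y ∈ Q.points ∧ y 2 = x 2 ∧ y ≠ x} ⊕
        (({k : ℤ // k ≠ 0} × {y : EuclideanSpace ℝ (Fin 3) // y ∈ Q.points ∧ y 2 = x 2}) ⊕
          (ℤ × {y : EuclideanSpace ℝ (Fin 3) // y ∈ Q.points ∧ y 2 = t}))) ≃
        {y : EuclideanSpace ℝ (Fin 3) //
          y ∈ {p : EuclideanSpace ℝ (Fin 3) | ∃ k : ℤ, ∃ x' ∈ Q.points,
            (x' 2 = t ∨ x' 2 = x 2) ∧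
            p = x' + ((2 * (x 2 - t)) * (k : ℝ)) • EuclideanSpace.single (2 : Fin 3) (1 : ℝ)}
          ∧ y ≠ x},
      (∀ y, (E (Sum.inl y)).1 = y.1) ∧
      (∀ q, (E (Sum.inr (Sum.inl q))).1 =
        q.2.1 + ((2 * (x 2 - t)) * (q.1.1 : ℝ)) • EuclideanSpace.single (2 : Fin 3) (1 : ℝ)) ∧
      (∀ q, (E (Sum.inr (Sum.inr q))).1 =
        q.2.1 + ((2 * (x 2 - t)) * ((-q.1 : ℤ) : ℝ)) •
          EuclideanSpace.single (2 : Fin 3) (1 : ℝ)) := by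
  have hc : x 2 - t ≠ 0 := (sub_pos.2 ht).ne'
  have hz : ∀ z : EuclideanSpace ℝ (Fin 3),
      z + ((2 * (x 2 - t)) * ((0 : ℤ) : ℝ)) • EuclideanSpace.single (2 : Fin 3) (1 : ℝ) = z :=
    fun z => by simp
  -- the forward map, piece by piece, with its three defining equations
  obtain ⟨F, hFA, hFB, hFC⟩ :
      ∃ F : ({y : EuclideanSpace ℝ (Fin 3) // y ∈ Q.points ∧ y 2 = x 2 ∧ y ≠ x} ⊕
          (({k : ℤ // k ≠ 0} × {y : EuclideanSpace ℝ (Fin 3) // y ∈ Q.points ∧ y 2 = x 2}) ⊕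
            (ℤ × {y : EuclideanSpace ℝ (Fin 3) // y ∈ Q.points ∧ y 2 = t}))) →
          {y : EuclideanSpace ℝ (Fin 3) //
            y ∈ {p : EuclideanSpace ℝ (Fin 3) | ∃ k : ℤ, ∃ x' ∈ Q.points,
              (x' 2 = t ∨ x' 2 = x 2) ∧
              p = x' + ((2 * (x 2 - t)) * (k : ℝ)) • EuclideanSpace.single (2 : Fin 3) (1 : ℝ)}
            ∧ y ≠ x},
        (∀ y, (F (Sum.inl y)).1 = y.1) ∧
        (∀ q, (F (Sum.inr (Sum.inl q))).1 =
          q.2.1 + ((2 * (x 2 - t)) * (q.1.1 : ℝ)) • EuclideanSpace.single (2 : Fin 3) (1 : ℝ)) ∧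
        (∀ q, (F (Sum.inr (Sum.inr q))).1 =
          q.2.1 + ((2 * (x 2 - t)) * ((-q.1 : ℤ) : ℝ)) •
            EuclideanSpace.single (2 : Fin 3) (1 : ℝ)) := by
    refine ⟨Sum.elim (fun y => ⟨y.1, ⟨0, y.1, y.2.1, Or.inr y.2.2.1, (hz y.1).symm⟩, y.2.2.2⟩)
      (Sum.elim
        (fun q => ⟨q.2.1 + ((2 * (x 2 - t)) * (q.1.1 : ℝ)) •
            EuclideanSpace.single (2 : Fin 3) (1 : ℝ),
          ⟨q.1.1, q.2.1, q.2.2.1, Or.inr q.2.2.2, rfl⟩, fun h => q.1.2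
            (restackDn_rep_unique hc (Or.inr q.2.2.2) (Or.inr rfl) (h.trans (hz x).symm)).1⟩)
        (fun q => ⟨q.2.1 + ((2 * (x 2 - t)) * ((-q.1 : ℤ) : ℝ)) •
            EuclideanSpace.single (2 : Fin 3) (1 : ℝ),
          ⟨-q.1, q.2.1, q.2.2.1, Or.inl q.2.2.2, rfl⟩, fun h => ?_⟩)),
      fun _ => rfl, fun _ => rfl, fun _ => rfl⟩
    obtain ⟨-, h2⟩ := restackDn_rep_unique hc (Or.inl q.2.2.2) (Or.inr rfl) (h.trans (hz x).symm)
    have h3 := q.2.2.2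
    rw [h2] at h3
    exact ht.ne' h3
  have hinj : Function.Injective F := by
    rintro (y | q | q) (y' | q' | q') h <;> have hv := congrArg Subtype.val h
    · rw [hFA, hFA] at hv
      rw [Subtype.ext hv]
    · rw [hFA, hFB] at hv
      exact absurd (restackDn_rep_unique hc (Or.inr y.2.2.1) (Or.inr q'.2.2.2)
        ((hz y.1).trans hv)).1.symm q'.1.2
    · rw [hFA, hFC] at hv
      obtain ⟨-, h2⟩ := restackDn_rep_unique hc (Or.inr y.2.2.1) (Or.inl q'.2.2.2)
        ((hz y.1).trans hv)
      have h3 := q'.2.2.2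
      rw [← h2, y.2.2.1] at h3
      exact absurd h3 ht.ne'
    · rw [hFB, hFA] at hv
      exact absurd (restackDn_rep_unique hc (Or.inr q.2.2.2) (Or.inr y'.2.2.1)
        (hv.trans (hz y'.1).symm)).1 q.1.2
    · rw [hFB, hFB] at hv
      obtain ⟨h1, h2⟩ := restackDn_rep_unique hc (Or.inr q.2.2.2) (Or.inr q'.2.2.2) hv
      rw [show q = q' from Prod.ext (Subtype.ext h1) (Subtype.ext h2)]
    · rw [hFB, hFC] at hv
      obtain ⟨-, h2⟩ := restackDn_rep_unique hc (Or.inr q.2.2.2) (Or.inl q'.2.2.2) hv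
      have h3 := q'.2.2.2
      rw [← h2, q.2.2.2] at h3
      exact absurd h3 ht.ne'
    · rw [hFC, hFA] at hv
      obtain ⟨-, h2⟩ := restackDn_rep_unique hc (Or.inl q.2.2.2) (Or.inr y'.2.2.1)
        (hv.trans (hz y'.1).symm)
      have h3 := q.2.2.2
      rw [h2, y'.2.2.1] at h3
      exact absurd h3 ht.ne'
    · rw [hFC, hFB] at hv
      obtain ⟨-, h2⟩ := restackDn_rep_unique hc (Or.inl q.2.2.2) (Or.inr q'.2.2.2) hv
      have h3 := q.2.2.2
      rw [h2, q'.2.2.2] at h3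
      exact absurd h3 ht.ne'
    · rw [hFC, hFC] at hv
      obtain ⟨h1, h2⟩ := restackDn_rep_unique hc (Or.inl q.2.2.2) (Or.inl q'.2.2.2) hv
      rw [show q = q' from Prod.ext (neg_injective h1) (Subtype.ext h2)]
  have hsurj : Function.Surjective F := by
    rintro ⟨p, ⟨k, x', hx', hxt, rfl⟩, hpx⟩
    rcases hxt with h2 | h2
    · refine ⟨Sum.inr (Sum.inr (-k, ⟨x', hx', h2⟩)), Subtype.ext ?_⟩
      rw [hFC]
      simp
    · by_cases hk : k = 0
      · subst hk
        refine ⟨Sum.inl ⟨x', hx', h2, fun h => hpx ((hz x').trans h)⟩, Subtype.ext ?_⟩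
        rw [hFA]
        exact (hz x').symm
      · refine ⟨Sum.inr (Sum.inl (⟨k, hk⟩, ⟨x', hx', h2⟩)), Subtype.ext ?_⟩
        rw [hFB]
  exact ⟨Equiv.ofBijective F ⟨hinj, hsurj⟩, hFA, hFB, hFC⟩

/-- **The site sum of the downward restack in layer form** (general occupied lower height `t`):
summability of the two outer families and the plane-by-plane identity of the module docstring.
[folklore] -/
theorem restackDn_siteSum (Q : PeriodicConfiguration 3) (x : EuclideanSpace ℝ (Fin 3)) (t : ℝ)
    (hab : ∃ a ∈ Q.lattice, ∃ b ∈ Q.lattice, a 2 = 0 ∧ b 2 = 0 ∧ LinearIndependent ℝ ![a, b])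
    (hx : x ∈ Q.points) (ht : t < x 2) (hocc : ∃ y ∈ Q.points, y 2 = t) :
    Summable (fun k : {k : ℤ // k ≠ 0} =>
        ∑' y : {y : EuclideanSpace ℝ (Fin 3) // y ∈ Q.points ∧ y 2 = x 2},
          lennardJones (Real.sqrt (‖x - y.1‖ ^ 2 + (2 * |(k : ℝ)| * (x 2 - t)) ^ 2))) ∧
      Summable (fun k : ℤ =>
        ∑' y : {y : EuclideanSpace ℝ (Fin 3) // y ∈ Q.points ∧ y 2 = t},
          lennardJones (Real.sqrt (‖x - y.1‖ ^ 2 - (x 2 - t) ^ 2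
            + (|2 * (k : ℝ) + 1| * (x 2 - t)) ^ 2))) ∧
      ∑' y : {y : EuclideanSpace ℝ (Fin 3) //
          y ∈ {p : EuclideanSpace ℝ (Fin 3) | ∃ k : ℤ, ∃ x' ∈ Q.points,
            (x' 2 = t ∨ x' 2 = x 2) ∧
            p = x' + ((2 * (x 2 - t)) * (k : ℝ)) • EuclideanSpace.single (2 : Fin 3) (1 : ℝ)}
          ∧ y ≠ x}, lennardJones (dist x y.1) =
        (∑' y : {y : EuclideanSpace ℝ (Fin 3) // y ∈ Q.points ∧ y 2 = x 2 ∧ y ≠ x},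
            lennardJones (dist x y.1)) +
        (∑' k : {k : ℤ // k ≠ 0},
          ∑' y : {y : EuclideanSpace ℝ (Fin 3) // y ∈ Q.points ∧ y 2 = x 2},
            lennardJones (Real.sqrt (‖x - y.1‖ ^ 2 + (2 * |(k : ℝ)| * (x 2 - t)) ^ 2))) +
        ∑' k : ℤ,
          ∑' y : {y : EuclideanSpace ℝ (Fin 3) // y ∈ Q.points ∧ y 2 = t},
            lennardJones (Real.sqrt (‖x - y.1‖ ^ 2 - (x 2 - t) ^ 2
              + (|2 * (k : ℝ) + 1| * (x 2 - t)) ^ 2)) := by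
  obtain ⟨B, hB⟩ := stub_restack Q hab t (x 2) ht hocc ⟨x, hx, rfl⟩
  obtain ⟨E, hEA, hEB, hEC⟩ := restackDn_equiv Q x ht
  -- the site sum of the restack is absolutely summable (the restack is periodic)
  have hsum := B.summable_lennardJones_dist_three x
  rw [hB] at hsum
  -- transport to the parameter space
  obtain ⟨g, hg⟩ : ∃ g : ({y : EuclideanSpace ℝ (Fin 3) // y ∈ Q.points ∧ y 2 = x 2 ∧ y ≠ x} ⊕
      (({k : ℤ // k ≠ 0} × {y : EuclideanSpace ℝ (Fin 3) // y ∈ Q.points ∧ y 2 = x 2}) ⊕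
        (ℤ × {y : EuclideanSpace ℝ (Fin 3) // y ∈ Q.points ∧ y 2 = t}))) → ℝ,
      ∀ s, g s = lennardJones (dist x (E s).1) := ⟨_, fun _ => rfl⟩
  have hgs' : Summable ((fun y => lennardJones (dist x y.1)) ∘ E) := E.summable_iff.2 hsum
  have hgs : Summable g := hgs'.congr fun s => (hg s).symm
  have hA : Summable fun a => g (Sum.inl a) := hgs.comp_injective Sum.inl_injective
  have hBC : Summable fun d => g (Sum.inr d) := hgs.comp_injective Sum.inr_injective
  have hB' : Summable fun q => g (Sum.inr (Sum.inl q)) := hBC.comp_injective Sum.inl_injective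
  have hC : Summable fun q => g (Sum.inr (Sum.inr q)) := hBC.comp_injective Sum.inr_injective
  -- pointwise identification of the three pieces
  have hptA : ∀ a : {y : EuclideanSpace ℝ (Fin 3) // y ∈ Q.points ∧ y 2 = x 2 ∧ y ≠ x},
      g (Sum.inl a) = lennardJones (dist x a.1) := fun a => by rw [hg, hEA]
  have hptB : ∀ q : {k : ℤ // k ≠ 0} × {y : EuclideanSpace ℝ (Fin 3) // y ∈ Q.points ∧ y 2 = x 2},
      g (Sum.inr (Sum.inl q)) =
        lennardJones (Real.sqrt (‖x - q.2.1‖ ^ 2 + (2 * |(q.1.1 : ℝ)| * (x 2 - t)) ^ 2)) := by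
    rintro ⟨⟨k, hk⟩, y, hy, hy2⟩
    rw [hg, hEB, restackDn_dist_shift]
    refine congrArg (fun r => lennardJones (Real.sqrt r)) ?_
    dsimp only
    rw [hy2, sub_self]
    linear_combination (-(4 * (x 2 - t) ^ 2)) * sq_abs (k : ℝ)
  have hptC : ∀ q : ℤ × {y : EuclideanSpace ℝ (Fin 3) // y ∈ Q.points ∧ y 2 = t},
      g (Sum.inr (Sum.inr q)) =
        lennardJones (Real.sqrt (‖x - q.2.1‖ ^ 2 - (x 2 - t) ^ 2
          + (|2 * (q.1 : ℝ) + 1| * (x 2 - t)) ^ 2)) := by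
    rintro ⟨k, y, hy, hy2⟩
    rw [hg, hEC, restackDn_dist_shift]
    refine congrArg (fun r => lennardJones (Real.sqrt r)) ?_
    dsimp only
    rw [hy2]
    push_cast
    linear_combination (-(x 2 - t) ^ 2) * sq_abs (2 * (k : ℝ) + 1)
  refine ⟨(hB'.prod).congr fun k => tsum_congr fun y => hptB (k, y),
    (hC.prod).congr fun k => tsum_congr fun y => hptC (k, y), ?_⟩
  rw [← E.tsum_eq (fun y => lennardJones (dist x y.1))]
  calc ∑' s, lennardJones (dist x (E s).1) = ∑' s, g s := tsum_congr fun s => (hg s).symm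
    _ = ∑' a, g (Sum.inl a) + ∑' d, g (Sum.inr d) := Summable.tsum_sum (f := g) hA hBC
    _ = ∑' a, g (Sum.inl a) + (∑' q, g (Sum.inr (Sum.inl q)) + ∑' q, g (Sum.inr (Sum.inr q))) := by
        rw [Summable.tsum_sum (f := fun d => g (Sum.inr d)) hB' hC]
    _ = ∑' a, g (Sum.inl a) + (∑' k, ∑' y, g (Sum.inr (Sum.inl (k, y)))
          + ∑' k, ∑' y, g (Sum.inr (Sum.inr (k, y)))) := by
        rw [hB'.tsum_prod, hC.tsum_prod]
    _ = _ := by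
        rw [add_assoc]
        exact congrArg₂ (· + ·) (tsum_congr hptA) (congrArg₂ (· + ·)
          (tsum_congr fun k => tsum_congr fun y => hptB (k, y))
          (tsum_congr fun k => tsum_congr fun y => hptC (k, y)))

/-- **Registered stub `siteSum_layers_restackDn` (R1c-Dn) — the site sum of the downward restack in
layer form.**  For a periodic configuration `Q` of `ℝ³` with two `ℝ`-independent horizontal
periods, a point `x ∈ Q.points` and an occupied height `τd (x 2) < x 2`, the Lennard-Jones site
sum at `x` of the downward restack
`{x' + 2(x 2 - τd (x 2))k • e₃ : k ∈ ℤ, x' ∈ Q.points, x'₂ ∈ {τd (x 2), x 2}}` equals the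
in-plane sum over the layer of `x`, plus the sum over the non-zero even vertical offsets
`2|k|(x 2 - τd (x 2))` of the layer of `x`, plus the sum over the odd vertical offsets
`|2k+1|(x 2 - τd (x 2))` of the layer `τd (x 2)` (horizontal distances
`‖x - y‖² - (x 2 - τd (x 2))²`), the two outer families being summable.  (The separation
hypothesis is not needed.) [folklore] -/
theorem siteSum_layers_restackDn :
    ∀ (Q : PeriodicConfiguration 3) (τd : ℝ → ℝ) (x : EuclideanSpace ℝ (Fin 3)),
      (∃ a ∈ Q.lattice, ∃ b ∈ Q.lattice, a 2 = 0 ∧ b 2 = 0 ∧ LinearIndependent ℝ ![a, b]) →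
      (∀ x' ∈ Q.points, ∀ y ∈ Q.points, x' 2 ≠ y 2 → (3 : ℝ) / 4 ≤ |x' 2 - y 2|) →
      x ∈ Q.points → τd (x 2) < x 2 → (∃ y ∈ Q.points, y 2 = τd (x 2)) →
      Summable (fun k : {k : ℤ // k ≠ 0} =>
        ∑' y : {y : EuclideanSpace ℝ (Fin 3) // y ∈ Q.points ∧ y 2 = x 2},
          lennardJones (Real.sqrt (‖x - y.1‖ ^ 2 + (2 * |(k : ℝ)| * (x 2 - τd (x 2))) ^ 2))) ∧
      Summable (fun k : ℤ =>
        ∑' y : {y : EuclideanSpace ℝ (Fin 3) // y ∈ Q.points ∧ y 2 = τd (x 2)},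
          lennardJones (Real.sqrt (‖x - y.1‖ ^ 2 - (x 2 - τd (x 2)) ^ 2
            + (|2 * (k : ℝ) + 1| * (x 2 - τd (x 2))) ^ 2))) ∧
      ∑' y : {y : EuclideanSpace ℝ (Fin 3) //
          y ∈ {p : EuclideanSpace ℝ (Fin 3) | ∃ k : ℤ, ∃ x' ∈ Q.points,
            (x' 2 = τd (x 2) ∨ x' 2 = x 2) ∧
            p = x' + ((2 * (x 2 - τd (x 2))) * (k : ℝ)) • EuclideanSpace.single (2 : Fin 3) (1 : ℝ)}
          ∧ y ≠ x}, lennardJones (dist x y.1) =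
        (∑' y : {y : EuclideanSpace ℝ (Fin 3) // y ∈ Q.points ∧ y 2 = x 2 ∧ y ≠ x},
            lennardJones (dist x y.1)) +
        (∑' k : {k : ℤ // k ≠ 0},
          ∑' y : {y : EuclideanSpace ℝ (Fin 3) // y ∈ Q.points ∧ y 2 = x 2},
            lennardJones (Real.sqrt (‖x - y.1‖ ^ 2 + (2 * |(k : ℝ)| * (x 2 - τd (x 2))) ^ 2))) +
        ∑' k : ℤ,
          ∑' y : {y : EuclideanSpace ℝ (Fin 3) // y ∈ Q.points ∧ y 2 = τd (x 2)},
            lennardJones (Real.sqrt (‖x - y.1‖ ^ 2 - (x 2 - τd (x 2)) ^ 2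
              + (|2 * (k : ℝ) + 1| * (x 2 - τd (x 2))) ^ 2)) :=
  fun Q τd x hab _ hx hτ hocc => restackDn_siteSum Q x (τd (x 2)) hab hx hτ hocc

end Summit.AtomisticToContinuum.Crystallization.Theorems.ChessboardParticlePlanesLjPlaneChessboard

end
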